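import Summits.Ventures.PercRepro.RankLevelSetBiIndepAvoidSkew

/-! # RankLevelSetBiIndepMixedExchange — THE MIXED (CONTAIN-`Y₁`, AVOID-`Y₂`) FAMILIES OF BI-INDEPENDENT SETS AND
THEIR FREE / ABSORBING DECOMPOSITION AT AN ELEMENT `y ∈ Y₂` (night-1 g31; dossier §43.7)

`mixedSets M Y₁ Y₂ k = {Z ∈ D_k : Y₁ ⊆ Z, Z ∩ Y₂ = ∅}` (level index; `Y₂ = ∅`: the contain-`Y₁` family, `Y₁ = ∅`:
the avoid-`Y₂` family), `mixedCount` its size. For `y ∈ Y₂` the family splits into the FREE part (`insert y Z`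
independent), which is the mixed family of the contraction `M ／ {y}` with `Y₂ ∖ {y}` (**`mixedFree_eq_contract`**),
and the ABSORBING part (`y ∈ cl Z`), which is fibred by the fundamental circuit `C` of `y` in `Z`
(**`ncard_mixedAbsorb_eq_sum`**); the fibre over `C` at level `k + 1` is, by the exchange bijection `P ↦ P ∖ {x}` of
g28 (`indep_iff_insert_sdiff`) for any `x ∈ C ∖ {y}` with `x ∉ Y₂`, the mixed family of the minor `(M ／ {y}) ＼ {x}`
with contain-set `(Y₁ ∪ (C ∖ {y})) ∖ {x}` and avoid-set `Y₂ ∖ {y}` (**`ncard_mixedFibre_eq`**); if `C ∖ {y} ⊆ Y₂` the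
fibre is empty (**`mixedFibre_eq_empty_of_subset`**), and it is empty at level `0`. This is g28/g30's avoid ladder
with the contain- and avoid-sets carried along; `RankLevelSetBiIndepMixedNormSkew` runs the normalized induction on
it. Every declaration has a docstring; imports: the cell's own modules and Mathlib only. Axioms: standard. -/

namespace PercRepro

open Set Matroid

variable {α : Type} (M : Matroid α) [M.Finite]

/-! ## The mixed families -/

/-- **The mixed family**: bi-independent `k`-sets containing `Y₁` and avoiding `Y₂`. -/
def mixedSets (Y₁ Y₂ : Set α) (k : ℕ) : Set (Set α) := {Z ∈ biIndep M k | Y₁ ⊆ Z ∧ Disjoint Z Y₂}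

/-- **The mixed count** `#mixedSets`. -/
noncomputable def mixedCount (Y₁ Y₂ : Set α) (k : ℕ) : ℕ := (mixedSets M Y₁ Y₂ k).ncard

/-- The mixed family is finite. -/
lemma mixedSets_finite (Y₁ Y₂ : Set α) (k : ℕ) : (mixedSets M Y₁ Y₂ k).Finite :=
  (biIndep_finite M k).subset fun _ h => h.1

omit [M.Finite] in
/-- With `Y₂ = ∅` the mixed count is the contain count. -/
lemma mixedCount_empty_right (Y₁ : Set α) (k : ℕ) : mixedCount M Y₁ ∅ k = biContainCount M Y₁ k := by
  unfold mixedCount mixedSets biContainCount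
  congr 1
  ext Z
  simp

omit [M.Finite] in
/-- With `Y₁ = ∅` the mixed count is the avoid count `#{Z ∈ D_k : Z ∩ Y₂ = ∅}`. -/
lemma mixedCount_empty_left (Y₂ : Set α) (k : ℕ) :
    mixedCount M ∅ Y₂ k = {Z ∈ biIndep M k | Disjoint Z Y₂}.ncard := by
  unfold mixedCount mixedSets
  congr 1
  ext Z
  simp

omit [M.Finite] in
/-- With `Y₂ = {y}` the mixed count at `Y₁ = ∅` is the avoid-`y` count. -/
lemma mixedCount_empty_singleton (y : α) (k : ℕ) : mixedCount M ∅ {y} k = yAvoidCount M y k := by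
  unfold mixedCount mixedSets yAvoidCount
  congr 1
  ext Z
  simp [Set.disjoint_singleton_right]

omit [M.Finite] in
/-- The avoid-set may be replaced by its trace on the ground set. -/
lemma mixedSets_avoid_inter_ground (Y₁ Y₂ : Set α) (k : ℕ) :
    mixedSets M Y₁ Y₂ k = mixedSets M Y₁ (Y₂ ∩ M.E) k := by
  ext Z
  simp only [mixedSets, Set.mem_setOf_eq]
  constructor
  · rintro ⟨hZ, hY₁, hd⟩
    exact ⟨hZ, hY₁, hd.mono_right Set.inter_subset_left⟩
  · rintro ⟨hZ, hY₁, hd⟩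
    refine ⟨hZ, hY₁, ?_⟩
    rw [Set.disjoint_left]
    intro z hzZ hzY
    exact (Set.disjoint_left.mp hd) hzZ ⟨hzY, hZ.1 hzZ⟩

/-! ## The free / absorbing split at `y ∈ Y₂` -/

/-- The free part of the mixed family at `y`: `insert y Z` independent. -/
def mixedFree (Y₁ Y₂ : Set α) (y : α) (k : ℕ) : Set (Set α) :=
  {Z ∈ mixedSets M Y₁ Y₂ k | M.Indep (insert y Z)}

/-- The absorbing part of the mixed family at `y`: `insert y Z` dependent. -/
def mixedAbsorb (Y₁ Y₂ : Set α) (y : α) (k : ℕ) : Set (Set α) :=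
  {Z ∈ mixedSets M Y₁ Y₂ k | ¬ M.Indep (insert y Z)}

/-- **The mixed count is the free part plus the absorbing part.** -/
lemma mixedCount_eq_free_add_absorb (Y₁ Y₂ : Set α) (y : α) (k : ℕ) :
    mixedCount M Y₁ Y₂ k = (mixedFree M Y₁ Y₂ y k).ncard + (mixedAbsorb M Y₁ Y₂ y k).ncard :=
  ncard_split_pred' (mixedSets M Y₁ Y₂ k) (mixedSets_finite M Y₁ Y₂ k) (fun Z => M.Indep (insert y Z))

omit [M.Finite] in
/-- **The free part is the mixed family of the contraction** `M ／ {y}`, with the avoid-set `Y₂ ∖ {y}`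
(for a non-loop `y ∈ Y₂`). -/
lemma mixedFree_eq_contract {y : α} (hy : M.IsNonloop y) {Y₁ Y₂ : Set α} (hyY : y ∈ Y₂) (k : ℕ) :
    mixedFree M Y₁ Y₂ y k = mixedSets (M.contract {y}) Y₁ (Y₂ \ {y}) k := by
  have hfree := lowFreeAt_eq_biIndep_contract M hy k
  ext Z
  simp only [mixedFree, mixedSets, Set.mem_setOf_eq]
  constructor
  · rintro ⟨⟨hZ, hY₁, hd⟩, hind⟩
    have hyZ : y ∉ Z := fun h => (Set.disjoint_left.mp hd) h hyY
    have hZ' : Z ∈ lowFreeAt M y k := ⟨hZ, hyZ, hind⟩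
    rw [hfree] at hZ'
    exact ⟨hZ', hY₁, hd.mono_right Set.sdiff_subset⟩
  · rintro ⟨hZ, hY₁, hd⟩
    have hZ' : Z ∈ lowFreeAt M y k := by rw [hfree]; exact hZ
    obtain ⟨hZb, hyZ, hind⟩ := hZ'
    refine ⟨⟨hZb, hY₁, ?_⟩, hind⟩
    rw [Set.disjoint_left]
    intro z hzZ hzY
    by_cases hzy : z = y
    · exact hyZ (hzy ▸ hzZ)
    · exact (Set.disjoint_left.mp hd) hzZ ⟨hzY, hzy⟩

/-! ## The absorbing part, fibred by the fundamental circuit -/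

/-- **The fibre of the absorbing part over a circuit `C ∋ y`**: the `k`-sets `P ⊆ E ∖ {y}` with `C ∖ {y} ⊆ P`,
`P` independent, `insert y ((E ∖ {y}) ∖ P)` independent, `Y₁ ⊆ P`, `P ∩ Y₂ = ∅`. -/
def mixedFibre (Y₁ Y₂ : Set α) (y : α) (C : Set α) (k : ℕ) : Set (Set α) :=
  {P : Set α | P ⊆ M.E \ {y} ∧ P.ncard = k ∧ C \ {y} ⊆ P ∧ M.Indep P ∧ M.Indep (insert y ((M.E \ {y}) \ P)) ∧
    Y₁ ⊆ P ∧ Disjoint P Y₂}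

omit [M.Finite] in
/-- The absorbing part is the mixed filter of g28's `lowAbsorbAt` (for `y ∈ Y₂`). -/
lemma mixedAbsorb_eq_filter {Y₁ Y₂ : Set α} {y : α} (hyY : y ∈ Y₂) (k : ℕ) :
    mixedAbsorb M Y₁ Y₂ y k = {Z ∈ lowAbsorbAt M y k | Y₁ ⊆ Z ∧ Disjoint Z Y₂} := by
  ext Z
  simp only [mixedAbsorb, mixedSets, lowAbsorbAt, Set.mem_setOf_eq]
  constructor
  · rintro ⟨⟨hZ, hY₁, hd⟩, hdep⟩
    exact ⟨⟨hZ, fun h => (Set.disjoint_left.mp hd) h hyY, hdep⟩, hY₁, hd⟩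
  · rintro ⟨⟨hZ, -, hdep⟩, hY₁, hd⟩
    exact ⟨⟨hZ, hY₁, hd⟩, hdep⟩

omit [M.Finite] in
/-- **The fibre of the absorbing part over `C` is `mixedFibre`.** -/
lemma mixedAbsorb_fibre_eq {y : α} (hyE : y ∈ M.E) {Y₁ Y₂ : Set α} (hyY : y ∈ Y₂) {C : Set α}
    (hC : M.IsCircuit C) (k : ℕ) :
    {Z ∈ mixedAbsorb M Y₁ Y₂ y k | M.fundCircuit y Z = C} = mixedFibre M Y₁ Y₂ y C k := by
  have h := lowAbsorbAt_fibre_eq M hyE hC k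
  ext Z
  rw [mixedAbsorb_eq_filter M hyY]
  simp only [Set.mem_setOf_eq, mixedFibre]
  constructor
  · rintro ⟨⟨hZ, hY₁, hd⟩, hfund⟩
    have hZ' : Z ∈ {Z ∈ lowAbsorbAt M y k | M.fundCircuit y Z = C} := ⟨hZ, hfund⟩
    rw [h] at hZ'
    obtain ⟨h1, h2, h3, h4, h5⟩ := hZ'
    exact ⟨h1, h2, h3, h4, h5, hY₁, hd⟩
  · rintro ⟨h1, h2, h3, h4, h5, hY₁, hd⟩
    have hZ' : Z ∈ {Z ∈ lowAbsorbAt M y k | M.fundCircuit y Z = C} := by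
      rw [h]; exact ⟨h1, h2, h3, h4, h5⟩
    exact ⟨⟨hZ'.1, hY₁, hd⟩, hZ'.2⟩

/-- The absorbing part is finite. -/
lemma mixedAbsorb_finite (Y₁ Y₂ : Set α) (y : α) (k : ℕ) : (mixedAbsorb M Y₁ Y₂ y k).Finite :=
  (mixedSets_finite M Y₁ Y₂ k).subset fun _ h => h.1

/-- **`#mixedAbsorb = Σ_{C ∋ y} #mixedFibre C`** (fibrewise by the fundamental circuit of `y`). -/
lemma ncard_mixedAbsorb_eq_sum {y : α} (hyE : y ∈ M.E) {Y₁ Y₂ : Set α} (hyY : y ∈ Y₂) (k : ℕ) :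
    (mixedAbsorb M Y₁ Y₂ y k).ncard = ∑ C ∈ circuitsThroughAt M y, (mixedFibre M Y₁ Y₂ y C k).ncard := by
  classical
  have hfin := mixedAbsorb_finite M Y₁ Y₂ y k
  rw [Set.ncard_eq_toFinset_card _ hfin]
  have hmem : ∀ Z ∈ hfin.toFinset, M.fundCircuit y Z ∈ circuitsThroughAt M y := by
    intro Z hZ
    rw [hfin.mem_toFinset, mixedAbsorb_eq_filter M hyY] at hZ
    exact fundCircuit_mem_circuitsThroughAt' M hyE hZ.1
  rw [Finset.card_eq_sum_card_fiberwise (f := fun Z => M.fundCircuit y Z) (t := circuitsThroughAt M y) hmem]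
  refine Finset.sum_congr rfl fun C hC => ?_
  rw [mem_circuitsThroughAt] at hC
  rw [← mixedAbsorb_fibre_eq M hyE hyY hC.1 k, ← Set.ncard_coe_finset]
  congr 1
  ext Z
  simp only [Finset.coe_filter, Set.Finite.mem_toFinset, Set.mem_setOf_eq]

omit [M.Finite] in
/-- **A fibre over a circuit whose `y`-free part lies in the avoid-set is empty.** -/
lemma mixedFibre_eq_empty_of_subset {Y₁ Y₂ : Set α} {y : α} {C : Set α} (hC : M.IsCircuit C) (hyC : y ∈ C)
    (hy : M.Indep {y}) (hsub : C \ {y} ⊆ Y₂) (k : ℕ) : mixedFibre M Y₁ Y₂ y C k = ∅ := by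
  apply Set.eq_empty_of_forall_notMem
  rintro P ⟨-, -, hCP, -, -, -, hd⟩
  obtain ⟨x, hxC, hxy⟩ := exists_mem_circuit_ne M (Matroid.indep_singleton.mp hy) hC hyC
  have hxP : x ∈ P := hCP ⟨hxC, fun h => hxy (Set.mem_singleton_iff.mp h)⟩
  exact (Set.disjoint_left.mp hd) hxP (hsub ⟨hxC, fun h => hxy (Set.mem_singleton_iff.mp h)⟩)

/-- **A fibre at level `0` is empty** (`C ∖ {y}` is nonempty). -/
lemma mixedFibre_zero_eq_empty {Y₁ Y₂ : Set α} {y : α} {C : Set α} (hC : M.IsCircuit C) (hyC : y ∈ C)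
    (hy : M.Indep {y}) : mixedFibre M Y₁ Y₂ y C 0 = ∅ := by
  apply Set.eq_empty_of_forall_notMem
  rintro P ⟨hPE, hP0, hCP, -, -, -, -⟩
  obtain ⟨x, hxC, hxy⟩ := exists_mem_circuit_ne M (Matroid.indep_singleton.mp hy) hC hyC
  have hPe : P = ∅ := (Set.ncard_eq_zero (M.ground_finite.subset (hPE.trans Set.sdiff_subset))).mp hP0
  rw [hPe] at hCP
  exact hCP ⟨hxC, fun h => hxy (Set.mem_singleton_iff.mp h)⟩

/-! ## The exchange: the fibre at level `k + 1` is a mixed family of the minor `(M ／ {y}) ＼ {x}` -/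

/-- **THE MIXED EXCHANGE**: for `x ∈ C ∖ {y}` with `x ∉ Y₂`, `P ↦ P ∖ {x}` is a bijection from the fibre over `C`
at level `k + 1` onto the mixed family of `(M ／ {y}) ＼ {x}` with contain-set `(Y₁ ∪ (C ∖ {y})) ∖ {x}` and
avoid-set `Y₂ ∖ {y}` at level `k`. -/
lemma ncard_mixedFibre_eq {y x : α} {C : Set α} (hC : M.IsCircuit C) (hyC : y ∈ C) (hxC : x ∈ C) (hxy : x ≠ y)
    (hy : M.Indep {y}) {Y₁ Y₂ : Set α} (hxY : x ∉ Y₂) (k : ℕ) :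
    (mixedFibre M Y₁ Y₂ y C (k + 1)).ncard =
      mixedCount ((M.contract {y}).delete {x}) ((Y₁ ∪ (C \ {y})) \ {x}) (Y₂ \ {y}) k := by
  have hxE : x ∈ M.E := hC.subset_ground hxC
  have hyE : y ∈ M.E := hC.subset_ground hyC
  unfold mixedCount mixedSets biIndep mixedFibre
  have hground : ((M.contract {y}).delete {x}).E = (M.E \ {y}) \ {x} := minor_ground_eq' M y x
  have hindep : ∀ T, ((M.contract {y}).delete {x}).Indep T ↔
      (Disjoint T {y} ∧ M.Indep (T ∪ {y})) ∧ Disjoint T {x} := minor_indep_iff' M hy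
  simp only [hground, hindep, Set.mem_setOf_eq]
  refine Set.ncard_congr (fun P _ => P \ {x}) ?_ ?_ ?_
  · rintro P ⟨hPE, hPcard, hCP, hPind, hPcind, hY₁, hd⟩
    have hyP : y ∉ P := fun h => (hPE h).2 rfl
    have hxP : x ∈ P := hCP ⟨hxC, hxy⟩
    have hcompl : ((M.E \ {y}) \ {x}) \ (P \ {x}) = (M.E \ {y}) \ P := by
      ext z
      simp only [Set.mem_sdiff, Set.mem_singleton_iff]
      constructor
      · rintro ⟨⟨hz, hzx⟩, hzP⟩
        exact ⟨hz, fun hzP' => hzP ⟨hzP', hzx⟩⟩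
      · rintro ⟨hz, hzP⟩
        exact ⟨⟨hz, fun hzx => hzP (hzx ▸ hxP)⟩, fun h => hzP h.1⟩
    refine ⟨⟨Set.sdiff_subset_sdiff_left hPE, ?_, ⟨⟨?_, ?_⟩, Set.disjoint_sdiff_left⟩, ?_⟩, ?_, ?_⟩
    · rw [Set.ncard_sdiff_singleton_of_mem hxP, hPcard]; rfl
    · exact Set.disjoint_singleton_right.mpr (fun h => hyP h.1)
    · rw [Set.union_singleton]
      exact (indep_iff_insert_sdiff M hC hyC hxC hxy hCP hyP).mp hPind
    · rw [hcompl]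
      refine ⟨⟨Set.disjoint_singleton_right.mpr (fun h => h.1.2 rfl), ?_⟩,
        Set.disjoint_singleton_right.mpr (fun h => h.2 hxP)⟩
      rw [Set.union_singleton]; exact hPcind
    · intro z hz
      rcases hz.1 with hz1 | hz1
      · exact ⟨hY₁ hz1, hz.2⟩
      · exact ⟨hCP hz1, hz.2⟩
    · exact (hd.mono_left Set.sdiff_subset).mono_right Set.sdiff_subset
  · rintro P P' ⟨-, -, hCP, -, -, -, -⟩ ⟨-, -, hCP', -, -, -, -⟩ h
    have hxP : x ∈ P := hCP ⟨hxC, hxy⟩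
    have hxP' : x ∈ P' := hCP' ⟨hxC, hxy⟩
    rw [← Set.insert_sdiff_self_of_mem hxP, ← Set.insert_sdiff_self_of_mem hxP', h]
  · rintro Z ⟨⟨hZE, hZcard, ⟨⟨hZy, hZind⟩, hZx⟩, ⟨⟨-, hZcind⟩, -⟩⟩, hXZ, hdZ⟩
    have hxZ : x ∉ Z := fun h => (hZE h).2 rfl
    have hyZ : y ∉ Z := fun h => (hZE h).1.2 rfl
    have hZfin : Z.Finite := M.ground_finite.subset (hZE.trans (Set.sdiff_subset.trans Set.sdiff_subset))
    have hCP : C \ {y} ⊆ insert x Z := by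
      intro z hz
      by_cases hzx : z = x
      · exact Or.inl hzx
      · exact Or.inr (hXZ ⟨Or.inr hz, hzx⟩)
    have hyP : y ∉ insert x Z := by
      rintro (h | h)
      · exact hxy h.symm
      · exact hyZ h
    have hcompl : ((M.E \ {y}) \ {x}) \ Z = (M.E \ {y}) \ insert x Z := by
      ext z
      simp only [Set.mem_sdiff, Set.mem_singleton_iff, Set.mem_insert_iff]
      tauto
    refine ⟨insert x Z, ⟨?_, ?_, hCP, ?_, ?_, ?_, ?_⟩, Set.insert_sdiff_self_of_notMem hxZ⟩
    · exact Set.insert_subset ⟨hxE, fun h => hxy (Set.mem_singleton_iff.mp h)⟩ (hZE.trans Set.sdiff_subset)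
    · rw [Set.ncard_insert_of_notMem hxZ hZfin, hZcard]
    · rw [indep_iff_insert_sdiff M hC hyC hxC hxy hCP hyP, Set.insert_sdiff_self_of_notMem hxZ,
        ← Set.union_singleton]
      exact hZind
    · rw [← hcompl, ← Set.union_singleton]; exact hZcind
    · intro z hz
      by_cases hzx : z = x
      · exact Or.inl hzx
      · exact Or.inr (hXZ ⟨Or.inl hz, hzx⟩)
    · rw [Set.disjoint_left]
      rintro z (rfl | hz) hzY
      · exact hxY hzY
      · exact (Set.disjoint_left.mp hdZ) hz ⟨hzY, fun h => hyZ (Set.mem_singleton_iff.mp h ▸ hz)⟩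

end PercRepro
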